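import Literature.MathematicalPhysics.QuantumFieldTheory.Balaban1983to89.T3UnitScaleTilt
import HarnessLib

/-!
# `Balaban1983to89.T3HistoryTailReduction` — rung R3, crux K2 REDUCED TO PER-HEIGHT LARGE-FIELD TAILS: the Gibbs mass of the
# complement of Bałaban's UV-small-history event is at most the SUM over the constrained heights of the single-height large-field
# probabilities (union bound), and the route's K2 body `HistoryTailAt F γ b₀ p₀ m` follows, for EVERY `m ≥ 1`, from a height-tail
# profile `q(i)` (distance `i` from the unit scale) whose tail sums are summable — the counting `Σ_K T(⌊K/m⌋) = m·Σ_n T(n)` made formal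

Cell `ym3-torus` (HUMAN RULING D-0037, YM ladder rung R3), seat `ym3-torus-p2` gen 3.  WHAT THIS IS NOT: not d = 4, not infinite
volume, not a mass gap, not Clay, and NOT K2: the per-height large-field tail `P_K(some plaquette of Ū^{j} is θ(K−j)-large) ≤ q(K−j)`
is the HYPOTHESIS — it is the probabilistic content of ultraviolet stability in d = 3 (printed INGREDIENT: the factors `exp(−¼p(g_j)²)`
per large plaquette of [Balaban1985UV3] (71) p.273 inside the renormalization-group representation; a bound on the GIBBS PROBABILITY of a
large block-averaged plaquette, uniform in the cutoff, is not printed).  What is PROVED here is the bookkeeping from that single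
estimate to the route's crux: (§1) `summable_comp_div` — for `T ≥ 0` summable and `m ≥ 1`, `K ↦ T(⌊K/m⌋)` is summable
(`Σ_{K<mM} T(⌊K/m⌋) = m·Σ_{n<M} T(n)`): the free top fraction `1/m` costs a factor `m`, nothing else; (§2) the UNION BOUND
`real_compl_histGood_le_sum`: `μ((histGood K n)ᶜ) ≤ Σ_{j ≤ K−n} μ{¬PlaqSmall θ(K−j) (Ū^{j})}` for every finite measure; (§3)
**`historyTailAt_of_heightTail`**: a profile `q ≥ 0` with tail envelope `T(n) ≥ Σ_{t<N} q(t+n)`, `Σ T(n) < ∞`, bounding the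
per-height large-field Gibbs probabilities of EVERY approximation at distance `i = K − j` from the unit scale, gives
`HistoryTailAt F γ b₀ p₀ m` with `w_K = T(⌊K/m⌋)` for every `m ≥ 1` — the same `w_K` serves run `K` and run `K+1` because both
events constrain exactly the heights at distance `≥ ⌊K/m⌋`.  Why `m = 0` is excluded: then every height of every approximation is
constrained, the unit-scale term `q(0)`-type mass does not decay in `K`, and K2 is false; for `m ≥ 1` the approximations `K < m`
contribute finitely many terms.
-/

noncomputable section

open MeasureTheory Filter Topology
open Literature.MathematicalPhysics.QuantumFieldTheory.Balaban1983to89.T3ContinuumYM3Torus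
open Literature.MathematicalPhysics.QuantumFieldTheory.Balaban1983to89.T3ThresholdRemoval
open Literature.MathematicalPhysics.QuantumFieldTheory.Balaban1983to89.T3UnitLawDensityEML (ℰp measurableE_ℰp)
open Literature.MathematicalPhysics.QuantumFieldTheory.Balaban1983to89.T3UnitScaleTilt
open Literature.MathematicalPhysics.QuantumFieldTheory.Balaban1983to89.Missing
open Literature.MathematicalPhysics.QuantumFieldTheory.Balaban1983to89.T4Continuum

namespace Literature.MathematicalPhysics.QuantumFieldTheory.Balaban1983to89.T3HistoryTailReduction

/-! ## §1 Counting: a free top fraction `1/m` costs a factor `m` -/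

section Counting

/-- `Σ_{K < mM} T(⌊K/m⌋) = m · Σ_{n < M} T(n)` (each value `n` of `⌊K/m⌋` is taken by exactly `m` consecutive `K`). [folklore] -/
private theorem sum_range_mul_comp_div (T : ℕ → ℝ) {m : ℕ} (hm : 0 < m) :
    ∀ M : ℕ, ∑ K ∈ Finset.range (m * M), T (K / m) = m * ∑ n ∈ Finset.range M, T n
  | 0 => by simp
  | M + 1 => by
    rw [Nat.mul_succ, Finset.sum_range_add, sum_range_mul_comp_div T hm M, Finset.sum_range_succ, mul_add]
    congr 1
    have h : ∀ t ∈ Finset.range m, T ((m * M + t) / m) = T M := fun t ht => by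
      rw [Nat.mul_add_div hm, Nat.div_eq_of_lt (Finset.mem_range.mp ht), add_zero]
    rw [Finset.sum_congr rfl h, Finset.sum_const, Finset.card_range, nsmul_eq_mul]

/-- **THE FREE TOP FRACTION COSTS A FACTOR `m`**: for `T ≥ 0` summable and `m ≥ 1` the sequence `K ↦ T(⌊K/m⌋)` is summable
(partial sums `≤ m·Σ T`).  This is why the route's K2 with `⌊K/m⌋` free top steps is plausible for EVERY `m ≥ 1` once it is for one.
[cite: King1986, (3.12) p.657] -/
theorem summable_comp_div {T : ℕ → ℝ} (hT0 : ∀ n, 0 ≤ T n) (hT : Summable T) {m : ℕ} (hm : 0 < m) :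
    Summable fun K => T (K / m) := by
  refine summable_of_sum_range_le (fun K => hT0 _) (c := m * ∑' n, T n) fun N => ?_
  have hsub : Finset.range N ⊆ Finset.range (m * (N / m + 1)) := by
    intro K hK
    rw [Finset.mem_range] at hK ⊢
    exact hK.trans (Nat.lt_mul_div_succ N hm)
  calc ∑ K ∈ Finset.range N, T (K / m)
      ≤ ∑ K ∈ Finset.range (m * (N / m + 1)), T (K / m) :=
        Finset.sum_le_sum_of_subset_of_nonneg hsub fun K _ _ => hT0 _
    _ = m * ∑ n ∈ Finset.range (N / m + 1), T n := sum_range_mul_comp_div T hm _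
    _ ≤ m * ∑' n, T n :=
        mul_le_mul_of_nonneg_left (hT.sum_le_tsum _ fun n _ => hT0 n) (Nat.cast_nonneg _)

/-- Reflection of a tail sum: `Σ_{j < K−n+1} q(K−j) = Σ_{t < K−n+1} q(t+n)` for `n ≤ K`. [folklore] -/
private theorem sum_range_reflect_tail (q : ℕ → ℝ) {K n : ℕ} (hn : n ≤ K) :
    ∑ j ∈ Finset.range (K - n + 1), q (K - j) = ∑ t ∈ Finset.range (K - n + 1), q (t + n) := by
  rw [← Finset.sum_range_reflect (fun t => q (t + n)) (K - n + 1)]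
  refine Finset.sum_congr rfl fun j hj => ?_
  rw [Finset.mem_range] at hj
  congr 1
  omega

end Counting

/-! ## §2 The union bound over the constrained heights -/

section UnionBound

variable (F : T3Family) {G : Type*} [GaugeGroup G] [MeasurableSpace G] (ℰ : LoopAverage G)

omit [MeasurableSpace G] in
/-- The complement of the UV-small-history event is covered by the single-height large-field events at the constrained heights
`j ≤ K − n`. [cite: Balaban1985UV3, (7) p.257] -/
theorem compl_histGood_subset (θ : ℕ → ℝ) (K n : ℕ) :
    (histGood F ℰ θ K n)ᶜ ⊆ ⋃ j ∈ Finset.range (K - n + 1),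
      {U | ¬ PlaqSmall (θ (K - j)) (Averaging.iter (fun i => BlockAveraging.blockAvg (P := F.P K) (j := i) ℰ) j U)} := by
  intro U hU
  simp only [histGood, Set.mem_compl_iff, Set.mem_setOf_eq, not_forall] at hU
  obtain ⟨j, hj, hbad⟩ := hU
  simp only [Set.mem_iUnion, Set.mem_setOf_eq, Finset.mem_range]
  exact ⟨j, by omega, hbad⟩

/-- **THE UNION BOUND**: for every finite measure `μ` on the fine fields of the `K`-th approximation,
`μ((histGood K n)ᶜ) ≤ Σ_{j < K−n+1} μ{¬PlaqSmall θ(K−j) (Ū^{j})}` — Bałaban's sum over the heights of the decomposition of unity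
(7), read as a probability bound. [cite: Balaban1985UV3, (7) p.257] -/
theorem real_compl_histGood_le_sum (θ : ℕ → ℝ) (K n : ℕ) (μ : Measure (GaugeField (F.P K) 0 G)) [IsFiniteMeasure μ] :
    μ.real (histGood F ℰ θ K n)ᶜ ≤ ∑ j ∈ Finset.range (K - n + 1),
      μ.real {U | ¬ PlaqSmall (θ (K - j)) (Averaging.iter (fun i => BlockAveraging.blockAvg (P := F.P K) (j := i) ℰ) j U)} :=
  (measureReal_mono (compl_histGood_subset F ℰ θ K n) (measure_ne_top _ _)).trans (measureReal_biUnion_finset_le _ _)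

end UnionBound

/-! ## §3 K2 from a per-height large-field tail profile, for every `m ≥ 1` -/

section Reduction

/-- **K2 ⇐ PER-HEIGHT LARGE-FIELD TAILS, EVERY `m ≥ 1`** (`SU(2)`, printed smearing, `γ ≥ 0`).  Hypotheses: a profile `q ≥ 0` on
distances `i` from the unit scale and an envelope `T ≥ 0` of its tail sums (`Σ_{t<N} q(t+n) ≤ T(n)`, `Σ_n T(n) < ∞`), and the
SINGLE-HEIGHT LARGE-FIELD BOUND for every approximation `K` and every height `j ≤ K`: the Gibbs probability that some plaquette of
the `j`-fold block-averaged field exceeds Bałaban's threshold `θ(K−j) = g_{K−j}p(g_{K−j})` is `≤ q(K−j)`.  Conclusion: the route's K2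
body `HistoryTailAt F γ b₀ p₀ m` with `w_K = T(⌊K/m⌋)`, serving run `K` and run `K+1` alike.  The hypothesis is the located, unprinted
probabilistic form of ultraviolet stability ([Balaban1985UV3] (71): `exp(−¼p(g_j)²)` per large plaquette). [cite: Balaban1985UV3, (71) p.273] -/
theorem historyTailAt_of_heightTail (F : T3Family) {γ : ℝ} (hγ : 0 ≤ γ) (b₀ p₀ : ℝ) {m : ℕ} (hm : 0 < m)
    (q T : ℕ → ℝ) (hT0 : ∀ n, 0 ≤ T n) (hT : Summable T)
    (hqT : ∀ n N, ∑ t ∈ Finset.range N, q (t + n) ≤ T n)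
    (htail : ∀ K j, j ≤ K → (gibbsK F ℰp γ K).real
      {U | ¬ PlaqSmall (θBal F.L γ b₀ p₀ (K - j))
        (Averaging.iter (fun i => BlockAveraging.blockAvg (P := F.P K) (j := i) ℰp) j U)} ≤ q (K - j)) :
    HistoryTailAt F γ b₀ p₀ m := by
  refine ⟨fun K => T (K / m), summable_comp_div hT0 hT hm, fun K => ?_⟩
  beta_reduce
  have hn0 : K / m ≤ K := Nat.div_le_self K m
  generalize K / m = n at hn0 ⊢
  constructor
  · -- run `K`, event `histGood K n`
    haveI := isProbabilityMeasure_gibbsK F ℰp hγ K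
    refine (real_compl_histGood_le_sum F ℰp (θBal F.L γ b₀ p₀) K n (gibbsK F ℰp γ K)).trans ?_
    refine (Finset.sum_le_sum fun j hj => htail K j ?_).trans ?_
    · have := Finset.mem_range.mp hj; omega
    · rw [sum_range_reflect_tail q hn0]
      exact hqT _ _
  · -- run `K+1`, event `histGood (K+1) n`
    haveI := isProbabilityMeasure_gibbsK F ℰp hγ (K + 1)
    have hn1 : n ≤ K + 1 := hn0.trans (Nat.le_succ K)
    refine (real_compl_histGood_le_sum F ℰp (θBal F.L γ b₀ p₀) (K + 1) n (gibbsK F ℰp γ (K + 1))).trans ?_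
    refine (Finset.sum_le_sum fun j hj => htail (K + 1) j ?_).trans ?_
    · have := Finset.mem_range.mp hj; omega
    · rw [sum_range_reflect_tail q hn1]
      exact hqT _ _

/-- The same with the profile's tail sums taken as the envelope (`T(n) := Σ' t, q(t+n)`), for a summable `q ≥ 0` whose tail sums
are summable — e.g. any super-polynomially decaying `q`, as `exp(−c·p(g_i)²)·#plaquettes(i)` with `p(g) = b₀(1+log g⁻¹)^{p₀}`,
`p₀ > 2`. [cite: Balaban1985UV3, (71) p.273] -/
theorem historyTailAt_of_heightTail' (F : T3Family) {γ : ℝ} (hγ : 0 ≤ γ) (b₀ p₀ : ℝ) {m : ℕ} (hm : 0 < m)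
    (q : ℕ → ℝ) (hq0 : ∀ i, 0 ≤ q i) (hq : Summable q) (hqt : Summable fun n => ∑' t, q (t + n))
    (htail : ∀ K j, j ≤ K → (gibbsK F ℰp γ K).real
      {U | ¬ PlaqSmall (θBal F.L γ b₀ p₀ (K - j))
        (Averaging.iter (fun i => BlockAveraging.blockAvg (P := F.P K) (j := i) ℰp) j U)} ≤ q (K - j)) :
    HistoryTailAt F γ b₀ p₀ m :=
  historyTailAt_of_heightTail F hγ b₀ p₀ hm q (fun n => ∑' t, q (t + n))
    (fun _ => tsum_nonneg fun _ => hq0 _) hqt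
    (fun n _ => ((summable_nat_add_iff n).mpr hq).sum_le_tsum _ fun _ _ => hq0 _) htail

end Reduction

/-! ## §4 The same reduction with the per-height hypothesis demanded ONLY ON THE HISTORY WEDGE `K ≤ m·(K − j + 1)`

The two events `histGood K ⌊K/m⌋` and `histGood (K+1) ⌊K/m⌋` bounded by `HistoryTailAt F γ b₀ p₀ m` constrain exactly the heights
`j ≤ K' − ⌊K/m⌋` of `K' ∈ {K, K+1}`; since `m·(⌊K/m⌋ + 1) ≥ K + 1`, every such pair satisfies the WEDGE GUARD `K' ≤ m·(K' − j + 1)`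
(remaining height `i = K' − j ≥ K'/m − 1`).  So the per-height hypothesis of `historyTailAt_of_heightTail` is needed only there — on the
wedge every coupling in play is `g²_{K'−j} = γL^{−(K'−j)} ≤ γL·L^{−K'/m}`, never a fixed physical scale (route `HistoryWedge`, crux
`WedgeTailL`; critic ruling idea-crit-5 #105: the wedge guard is a standing free hypothesis of every per-height / per-plaquette lever). -/

section Wedge

/-- **K2 ⇐ PER-HEIGHT LARGE-FIELD TAILS ON THE HISTORY WEDGE ONLY** (`SU(2)`, printed smearing, `γ ≥ 0`, every `m ≥ 1`): as
`historyTailAt_of_heightTail`, but the single-height large-field bound `Gibbs_K{¬PlaqSmall θ(K−j) (Ū^{j})} ≤ q(K−j)` is assumed only for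
the pairs `j ≤ K` with the WEDGE GUARD `K ≤ m·(K − j + 1)`.  Conclusion unchanged: `HistoryTailAt F γ b₀ p₀ m` with `w_K = T(⌊K/m⌋)`
(run `K`: the union bound sums over `j ≤ K − ⌊K/m⌋`, where `K ≤ m(⌊K/m⌋+1) ≤ m(K−j+1)`; run `K+1`: over `j ≤ K+1−⌊K/m⌋`, where
`K+1 ≤ m(⌊K/m⌋+1) ≤ m(K+1−j+1)`).  `historyTailAt_of_heightTail` is the special case that ignores the guard.
[cite: Balaban1985UV3, (7) p.257 and (71) p.273; King1986, (3.12) p.657] -/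
theorem historyTailAt_of_heightTailOnWedge (F : T3Family) {γ : ℝ} (hγ : 0 ≤ γ) (b₀ p₀ : ℝ) {m : ℕ} (hm : 0 < m)
    (q T : ℕ → ℝ) (hT0 : ∀ n, 0 ≤ T n) (hT : Summable T)
    (hqT : ∀ n N, ∑ t ∈ Finset.range N, q (t + n) ≤ T n)
    (htail : ∀ K j, j ≤ K → K ≤ m * (K - j + 1) → (gibbsK F ℰp γ K).real
      {U | ¬ PlaqSmall (θBal F.L γ b₀ p₀ (K - j))
        (Averaging.iter (fun i => BlockAveraging.blockAvg (P := F.P K) (j := i) ℰp) j U)} ≤ q (K - j)) :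
    HistoryTailAt F γ b₀ p₀ m := by
  refine ⟨fun K => T (K / m), summable_comp_div hT0 hT hm, fun K => ?_⟩
  beta_reduce
  have hn0 : K / m ≤ K := Nat.div_le_self K m
  have hKm : K < m * (K / m + 1) := Nat.lt_mul_div_succ K hm
  generalize K / m = n at hn0 hKm ⊢
  constructor
  · -- run `K`, event `histGood K n`: heights `j ≤ K − n`, all on the wedge
    haveI := isProbabilityMeasure_gibbsK F ℰp hγ K
    refine (real_compl_histGood_le_sum F ℰp (θBal F.L γ b₀ p₀) K n (gibbsK F ℰp γ K)).trans ?_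
    refine (Finset.sum_le_sum fun j hj => htail K j ?_ ?_).trans ?_
    · have := Finset.mem_range.mp hj; omega
    · have := Finset.mem_range.mp hj
      calc K ≤ m * (n + 1) := hKm.le
        _ ≤ m * (K - j + 1) := Nat.mul_le_mul_left m (by omega)
    · rw [sum_range_reflect_tail q hn0]
      exact hqT _ _
  · -- run `K+1`, event `histGood (K+1) n`: heights `j ≤ K + 1 − n`, all on the wedge
    haveI := isProbabilityMeasure_gibbsK F ℰp hγ (K + 1)
    have hn1 : n ≤ K + 1 := hn0.trans (Nat.le_succ K)
    refine (real_compl_histGood_le_sum F ℰp (θBal F.L γ b₀ p₀) (K + 1) n (gibbsK F ℰp γ (K + 1))).trans ?_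
    refine (Finset.sum_le_sum fun j hj => htail (K + 1) j ?_ ?_).trans ?_
    · have := Finset.mem_range.mp hj; omega
    · have := Finset.mem_range.mp hj
      calc K + 1 ≤ m * (n + 1) := hKm
        _ ≤ m * (K + 1 - j + 1) := Nat.mul_le_mul_left m (by omega)
    · rw [sum_range_reflect_tail q hn1]
      exact hqT _ _

/-- The same with the profile's tail sums taken as the envelope (`T(n) := Σ' t, q(t+n)`), for a summable `q ≥ 0` whose tail sums are
summable; the wedge twin of `historyTailAt_of_heightTail'`. [cite: Balaban1985UV3, (71) p.273] -/
theorem historyTailAt_of_heightTailOnWedge' (F : T3Family) {γ : ℝ} (hγ : 0 ≤ γ) (b₀ p₀ : ℝ) {m : ℕ} (hm : 0 < m)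
    (q : ℕ → ℝ) (hq0 : ∀ i, 0 ≤ q i) (hq : Summable q) (hqt : Summable fun n => ∑' t, q (t + n))
    (htail : ∀ K j, j ≤ K → K ≤ m * (K - j + 1) → (gibbsK F ℰp γ K).real
      {U | ¬ PlaqSmall (θBal F.L γ b₀ p₀ (K - j))
        (Averaging.iter (fun i => BlockAveraging.blockAvg (P := F.P K) (j := i) ℰp) j U)} ≤ q (K - j)) :
    HistoryTailAt F γ b₀ p₀ m :=
  historyTailAt_of_heightTailOnWedge F hγ b₀ p₀ hm q (fun n => ∑' t, q (t + n))
    (fun _ => tsum_nonneg fun _ => hq0 _) hqt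
    (fun n _ => ((summable_nat_add_iff n).mpr hq).sum_le_tsum _ fun _ _ => hq0 _) htail

/-- The unrestricted reduction `historyTailAt_of_heightTail` recovered from the wedge form (the guard is simply dropped) — recorded so
that consumers may cite either shape. [cite: Balaban1985UV3, (71) p.273] -/
theorem historyTailAt_of_heightTail_of_onWedge (F : T3Family) {γ : ℝ} (hγ : 0 ≤ γ) (b₀ p₀ : ℝ) {m : ℕ} (hm : 0 < m)
    (q T : ℕ → ℝ) (hT0 : ∀ n, 0 ≤ T n) (hT : Summable T)
    (hqT : ∀ n N, ∑ t ∈ Finset.range N, q (t + n) ≤ T n)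
    (htail : ∀ K j, j ≤ K → (gibbsK F ℰp γ K).real
      {U | ¬ PlaqSmall (θBal F.L γ b₀ p₀ (K - j))
        (Averaging.iter (fun i => BlockAveraging.blockAvg (P := F.P K) (j := i) ℰp) j U)} ≤ q (K - j)) :
    HistoryTailAt F γ b₀ p₀ m :=
  historyTailAt_of_heightTailOnWedge F hγ b₀ p₀ hm q T hT0 hT hqT fun K j hj _ => htail K j hj

end Wedge

end Literature.MathematicalPhysics.QuantumFieldTheory.Balaban1983to89.T3HistoryTailReduction

end
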